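import Mathlib
import Summits.Ventures.PercRepro2.Defs
import Summits.Ventures.PercRepro2.Independence
import Summits.Ventures.PercRepro2.Harris
import Summits.Ventures.PercRepro2.Graph
import Summits.Ventures.PercRepro2.Events
import Summits.Ventures.PercRepro2.ZCLeafBuilt
import Summits.Ventures.PercRepro2.ZCDismantle
import Summits.Ventures.PercRepro2.ZCDismantleCoincide

/-!
# Dismantling to coincident marks at work: a graph containing `K₄`
(blind cell PercRepro2, mine-a g25; MINE-A.md §73)

The 7-vertex, 12-edge graph `c7_00499` of the cell's lists — edges `{0,1} {0,2} {1,5} {1,6} {2,5} {2,6}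
{3,4} {3,5} {3,6} {4,5} {4,6} {5,6}`; the vertices `3, 4, 5, 6` span a `K₄`, so NO complete dismantling
exists for any marks — with the marks `(0, 1, 5)`: F at `0` (`w = 2`), H at `2` (`w = 6`), E at `1`
(`w = 5 = o`) bring the `a₃`-mark onto `o`, and `zc_of_dismantling_coincide` proves (ZC) for every weight
vector and every cluster up-set, the `K₄` untouched.  Every side condition by `decide` / `simp`.
-/

namespace Summit.Ventures.PercRepro2

/-- **(ZC) on `c7_00499` (a `K₄` plus three vertices) with the marks `(0, 1, 5)`**, by three degree-two
insertions ending in coincident marks. -/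
theorem zc_k4_plus_three {R : Type*} [CommRing R] [LinearOrder R] [IsStrictOrderedRing R]
    {p : Fin 12 → R} (hp : IsProbVec p) {𝓔 : Set (Set (Fin 7))} (h𝓔 : IsUpperSet 𝓔) :
    let ends : Fin 12 → Sym2 (Fin 7) := ![s(0, 1), s(0, 2), s(1, 5), s(1, 6), s(2, 5), s(2, 6),
      s(3, 4), s(3, 5), s(3, 6), s(4, 5), s(4, 6), s(5, 6)]
    let e := connEvent ends 0 1
    let L' := connEvent ends 0 5
    let U := clusterInEvent ends 0 𝓔
    let γ := connEvent ends 1 5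
    0 ≤ prob p (eᶜ ∩ L'ᶜ ∩ γᶜ) * (prob p (U ∩ (e ∩ L')) - prob p U * prob p (e ∩ L'))
      - prob p (eᶜ ∩ L'ᶜ ∩ γ) * (prob p (U ∩ (e ∩ L'ᶜ)) - prob p U * prob p (e ∩ L'ᶜ)) := by
  intro ends e L' U γ
  have h := zc_of_dismantling_coincide (ends := ends)
    [((1 : Fin 5), (0 : Fin 12), (1 : Fin 12), (0 : Fin 7), (2 : Fin 7), (0 : Fin 7), (1 : Fin 7), (5 : Fin 7)),
     (3, 4, 5, 2, 6, 2, 1, 5),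
     (0, 3, 2, 1, 5, 6, 1, 5)]
    (by decide) (by decide) (by decide) p hp
    (by intro r hr e he; fin_cases hr <;> fin_cases e <;> simp_all [ends, Sym2.mem_iff])
    (0, 1, 5) (by intro r hr; simp at hr; rw [← hr]) (by decide) h𝓔
  simpa using h

end Summit.Ventures.PercRepro2
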